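import Summits.QuantumFields.BalabanUV.T4Continuum.Spine.NE1p.DressedTowerWitnessAction
import Summits.QuantumFields.BalabanUV.T4Continuum.Spine.NE1p.DressedExponentDepth

/-!
# T⁴ programme, spine estimate NE1′ (node O3b/H2) — ROW S9's (VAL-θ) JOIN INHABITED AT FUNCTION LEVEL AT EVERY CUTOFF: row W9's
# live action exponent READ AS «new part + ONE live old piece», the (w2-act) binder `hE` DERIVED by `exponentSliceAt_of_valDepth`
# BY NAME, and the assembled slice-window END run with the DERIVED history-indexed margin (formalisation crew
# `b2b-balaban-t4-ne1p-formalise-*`, leaf seat 03, generation 3, witness item W11; own-initiative consistency item, NOT a crew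
# estimate row; INTENT CLAIMS.log 2026-08-20T10:45Z)

Cell `pub-balaban`, sub-cell `t4`, BINDER-OWNERS row NE1′ (owner lineage t4-ne1p-p1).  ADDITIVE — imports this seat's row W9 part 1
`Spine/NE1p/DressedTowerWitnessAction` (p215115: the live exponent `𝒜A U z = −U₀₀·z₀₀`, the carried functionals `FnA` defined by the
dressed recursion, `FnA_succ`, `hslA`, `realBaseAt_A`, `hlinA`, `hbirthA`, `cM_le_two`, `psi_le_quarter`; through it rows W7 ∕ W5,
`ref₁ = Re`, the schedule `Wm`, leaf-04's assembled slice-window END) and leaf-04-g2's row S9 `Spine/NE1p/DressedExponentDepth`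
(p215209: **`exponentSliceAt_of_valDepth`** — the (w2-act) exponent slice with a HISTORY-INDEXED margin from the (VAL-θ) SHAPE)
ONLY; modifies nothing.

WHY.  Row S9 refines END-F's displayed (w2-act) binder `hE` one level: the action exponent is read as the new step's part plus old
PIECES `t_i` at layer values `val U i`, each analytic with sup `N_i` on an open birth domain with a room `ρ_i` about the reference
value, the layer values moving by `≤ c_V·θ_i·ρ_i` along admissible chart moves ((VAL-θ), road P2's located estimate — DISPLAYED), and
concludes `hE` with the margin `s_new + Σ_i 2·N_i·(c_V θ_i)`.  No witness inhabits that binder block yet.  Here row W9's decided toy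
does, UNIFORMLY IN THE CUTOFF, with a LIVE old piece:
* §1 the layered reading of W9's exponent: `𝒜A U z = zeroExp U z + Σ_{i ∈ {()}} t (val U i) z` with ONE OLD PIECE
  **`tPiece V z := −V·z₀₀`** at the layer value **`val U := U₀₀`** (`h𝒜` as an EQUATION); the piece is entire in `V`, with sup
  `N_k := (7∕2)·α_k` on the birth domain `S := ball 0 (7∕2) ⊂ ℂ` for a.e. fluctuation (`α_k = ψ^{k+1}∕4` the atom); the new part
  `zeroExp` has its own slice with margin `0` (`exponentSliceAt_zero`); room `ρ = 3` about the reference value `Re U₀₀` inside `S`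
  (`|Re U₀₀| ≤ ½` on the window); and THE (VAL-θ) BLOCK on the toy: along every admissible move `latMove U₀ p τ`, `τ ∈ Ω =
  ball 0 ((ϱc k + 9∕8)∕N p)`, the layer value `U₀₀ + τ·p₀₀` is entire in `τ` and stays within `½ + (ϱc k + 9∕8) + ½ ≤ 19∕8 = c_Vθ·ρ`
  of `Re U₀₀`, with `c_V·θ = 19∕24 < 1`.  Hence **`exponentSliceAt_A_depth k`**: W9's `hE`-binder type at the DERIVED margin
  **`sD k := (133∕24)·(ψ^{k+1}∕4)`** (`= 0 + 2·N_k·(19∕24)`), by S9's join BY NAME; and `sD_le_half : sD k ≤ ½ = s̄⁰`.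
* §2 the assembled slice-window END BY NAME with the derived margin AS the action margin at every step (**`htrAD K`**, gate
  `budgetGate (TM K) (fun _ k => sD k) ¼ {b} …`), the bundle `leavesAD K : BookingLeaves UW (BM K) (TM K)` (`hs₀ := sD_le_half`), END-B
  `classAt_towerAD`, and the root as an `example` (statement = W7's landed `dressedStability_towerM`).

HONEST FRAMING.  A decided toy ([folklore]; 0 sorry; 0 citations; no `def … : Prop` — the `def`s are ℝ∕ℂ-valued TERMS and one
`BookingLeaves`-valued term): S9's (VAL-θ) block, its (1.69)-TYPE piece data and its dictionary are INHABITED BY TOY DATA ONLY —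
this says NOTHING about road P2's located estimate or about [Balaban1989LargeFieldII] (1.61)–(1.63)∕(1.69) on the real densities;
observable coupling `c := 0`, `rel = Eq`, two-atom laws, one family as in W9 (declared).  Headline (c4): «S9's join is non-vacuous
at function level, uniformly in K, with a live old piece, and its output margin fits under THE NUMBER on the toy — non-vacuity of
SHAPES; NE1′ ⇐ the named binders, NOT proved»; spine PROVED 0∕9.  Rung (B)+1 on ONE finite four-torus — NOT infinite volume, NOT a
mass gap, NOT OS on ℝ⁴, NOT Clay, NOT summit progress.  HONEST DEPENDENCY: continuum YM on T⁴ ⇐ BetaPertH ∧ nine spine estimates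
(0/9 proved); BetaPertH ⇐ (D1) ∧ (D4) ∧ CAP+tail; G-an2-4 gates asym, D1 and NE2/3/4.
-/

noncomputable section

namespace Summit.QuantumFields.BalabanUV.T4Continuum.NE1p.DressedTowerWitnessDepth

open MeasureTheory Set Metric Filter Finset
open scoped BigOperators
open Literature.MathematicalPhysics.QuantumFieldTheory.Balaban1983to89
open Literature.MathematicalPhysics.QuantumFieldTheory.Balaban1983to89.T4TermFormat
open Literature.MathematicalPhysics.QuantumFieldTheory.Balaban1983to89.T4TermFormat.Booking
open Literature.MathematicalPhysics.QuantumFieldTheory.Balaban1983to89.T4GatedBooking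
open Literature.MathematicalPhysics.QuantumFieldTheory.Balaban1983to89.T4TrajectoryComparison
open T4TrajectoryModulus (bondBall bondBall_add_mem bondBall_latMove_add_mem bondBall_diam)
open T4BlockTransport (Fld NDir latMove latN Site norm_dir_le)
open T4BirthChartTransport (GaugeInvariant BirthSlice RelGauge)
open T4TrajectoryDensity
open Summit.QuantumFields.BalabanUV.T4Continuum.T4TrajectoryDensityDressed
open Summit.QuantumFields.BalabanUV.T4Continuum.T4TrajectoryDensityWitness
open Summit.QuantumFields.BalabanUV.T4Continuum.NE1p.DressedRoot
open Summit.QuantumFields.BalabanUV.T4Continuum.NE1p.DressedUniformConstants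
open Summit.QuantumFields.BalabanUV.T4Continuum.NE1p.DressedWindowScheduleWin
open Summit.QuantumFields.BalabanUV.T4Continuum.NE1p.DressedWindowScheduleModWin
open Summit.QuantumFields.BalabanUV.T4Continuum.NE1p.DressedTowerWitness
open Summit.QuantumFields.BalabanUV.T4Continuum.NE1p.DressedTowerWitnessSlice
open Summit.QuantumFields.BalabanUV.T4Continuum.NE1p.DressedTowerWitnessAction
open Summit.QuantumFields.BalabanUV.T4Continuum.NE1p.DressedTransportAssembledModData
open Summit.QuantumFields.BalabanUV.T4Continuum.NE1p.DressedTransportAssembledModSliceWin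
open Summit.QuantumFields.BalabanUV.T4Continuum.NE1p.DressedExponentDepth

/-! ## §1 The layered reading of W9's exponent and S9's join on the datum [decided toy] -/

/-- THE ONE OLD PIECE [decided toy]: `tPiece V z := −V·z₀₀` — a function of the layer value `V ∈ ℂ` (entire) and the fluctuation. [folklore] -/
def tPiece (_ : Unit) (V : ℂ) (z : Fld 4 ℂ) : ℂ := -(V * ev₀₀ z)

/-- THE LAYER VALUE MAP [decided toy]: `val U := U₀₀`. [folklore] -/
def valA (U : Fld 4 ℂ) (_ : Unit) : ℂ := ev₀₀ U

/-- The DERIVED history-indexed margin at step `k`: `sD k := (133∕24)·α_k` (`= 0 + 2·((7∕2)·α_k)·(19∕24)`, `α_k = ψ^{k+1}∕4`). [folklore] -/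
def sD (k : ℕ) : ℝ := 133 / 24 * dfW k

/-- [arith] [folklore] S9's output margin on the toy in closed form. -/
theorem sD_eq (k : ℕ) :
    (0 : ℝ) + ∑ i ∈ ({()} : Finset Unit), 2 * ((fun _ : Unit => 7 / 2 * dfW k) i) * (19 / 24 * (fun _ : Unit => (1 : ℝ)) i) =
      sD k := by
  rw [Finset.sum_singleton, sD]; ring

/-- **THE DERIVED MARGIN FITS UNDER THE NUMBER** [folklore]: `sD k ≤ (133∕24)·(ψ∕4) ≤ ½ = s̄⁰` at every step (`ψ ≤ ¼`). -/
theorem sD_le_half (k : ℕ) : sD k ≤ 1 / 2 := by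
  have h0 := psi_pos; have h4 := psi_le_quarter
  have hP : ((LW ^ 2)⁻¹) ^ (k + 1) ≤ (LW ^ 2)⁻¹ := by
    rw [pow_succ]; exact mul_le_of_le_one_left h0.le (psi_pow_le_one k)
  unfold sD dfW
  nlinarith

/-- [arith] [folklore] -/ theorem sD_pos (k : ℕ) : 0 < sD k := by unfold sD; have := dfW_pos k; positivity

/-- The DICTIONARY `h𝒜` AS AN EQUATION: W9's exponent IS the new part `0` plus the one old piece at the layer value. [folklore] -/
theorem h𝒜_layered (U z : Fld 4 ℂ) : 𝒜A U z = zeroExp U z + ∑ i ∈ ({()} : Finset Unit), tPiece i (valA U i) z := by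
  simp [𝒜A, zeroExp, tPiece, valA]

/-- The new part's own slice: the ZERO exponent about ANY reference has oscillation `0`. [folklore] -/
theorem exponentSliceAt_zero (ref : Fld 4 ℂ → Fld 4 ℂ) (a : Fld 4 ℂ) (S : Set (Fld 4 ℂ)) (w' ϱ : ℝ) :
    ExponentSliceAt ref zeroExp (flAt a) latMove latN S w' ϱ 0 := fun _ _ _ _ _ =>
  ⟨univ, isOpen_univ, fun _ _ => subset_univ _, fun _ _ => aesm_flAt a _,
    Eventually.of_forall fun _ => by simp only [zeroExp]; exact differentiableOn_const 0,
    Eventually.of_forall fun _ _ _ => by simp [zeroExp]⟩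

/-- [arith] [folklore] On the window of step `k+1` the background coordinate is small: `‖U₀₀‖ ≤ c_M·ψ^{k+1} ≤ ½`. -/
theorem norm_ev₀₀_le_half {k : ℕ} {U₀ : Fld 4 ℂ} (hU₀ : U₀ ∈ (bondBall 4 (Wm.ρw (k + 1)) : Set (Fld 4 ℂ))) :
    ‖ev₀₀ U₀‖ ≤ 1 / 2 := by
  have h0 := psi_pos; have h4 := psi_le_quarter; have hc := cM_le_two; have hc0 := cM_pos
  have hP : ((LW ^ 2)⁻¹) ^ (k + 1) ≤ (LW ^ 2)⁻¹ := by
    rw [pow_succ]; exact mul_le_of_le_one_left h0.le (psi_pow_le_one k)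
  have hv : ‖ev₀₀ U₀‖ ≤ cM * ((LW ^ 2)⁻¹) ^ (k + 1) := by rw [← Wm_ρw]; exact hU₀ 0 0
  nlinarith

/-- **ROW S9's JOIN ON THE DATUM — W9's (w2-act) BINDER `hE` DERIVED FROM A DISPLAYED DEPTH DATUM WITH A LIVE OLD PIECE, AT EVERY
CUTOFF** [decided toy]: `ExponentSliceAt ref₁ 𝒜A (flAt (atomW (k+1))) latMove latN (bondBall (ρw (k+1))) (wc (k+1)) (ϱc k) (sD k)`
by leaf-04-g2's `exponentSliceAt_of_valDepth` BY NAME, every hypothesis of its binder block inhabited on the toy: dictionary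
`h𝒜_layered`; new part `exponentSliceAt_zero`; the piece entire in the layer value with sup `(7∕2)·α_k` on `ball 0 (7∕2)` for a.e.
fluctuation, measurable; room `3` about `Re U₀₀` inside the birth domain; the (VAL-θ) block with `Ω = ball 0 ((ϱc k + 9∕8)∕N p)`,
`c_V·θ = 19∕24 < 1`, displacement `≤ 19∕8 = c_Vθ·3`.  Nothing of road P2's estimate on Bałaban's densities. [folklore] -/
theorem exponentSliceAt_A_depth (k : ℕ) :
    ExponentSliceAt ref₁ 𝒜A (flAt (atomW (k + 1))) latMove latN (bondBall 4 (Wm.ρw (k + 1)) : Set (Fld 4 ℂ))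
      (Wm.wc (k + 1)) (Wm.ϱc k) (sD k) := by
  have hψ0 := psi_pos; have hψ4 := psi_le_quarter
  have hP : ((LW ^ 2)⁻¹) ^ (k + 1) ≤ (LW ^ 2)⁻¹ := by
    rw [pow_succ]; exact mul_le_of_le_one_left hψ0.le (psi_pow_le_one k)
  have hϱ : Wm.ϱc k = ((LW ^ 2)⁻¹) ^ (k + 1) := by rw [Wm_ϱc, one_mul]
  have hϱle : Wm.ϱc k ≤ 1 / 4 := by rw [hϱ]; linarith
  have h := exponentSliceAt_of_valDepth (E := ℂ) (ref := ref₁) (𝒜 := 𝒜A) (𝒜new := zeroExp) (μ := flAt (atomW (k + 1)))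
    (𝒦 := (bondBall 4 (Wm.ρw (k + 1)) : Set (Fld 4 ℂ))) (w := Wm.wc (k + 1)) (ϱ := Wm.ϱc k) (snew := 0) (cV := 19 / 24)
    ({()} : Finset Unit) (val := valA) (t := tPiece) (S := fun _ => ball (0 : ℂ) (7 / 2))
    (N := fun _ => 7 / 2 * dfW k) (θ := fun _ => 1) (ρ := fun _ => 3)
    h𝒜_layered (exponentSliceAt_zero ref₁ _ _ _ _) (fun _ _ => isOpen_ball)
    (fun _ _ => Eventually.of_forall fun z => by simp only [tPiece]; fun_prop)
    (fun _ _ V _ => aesm_flAt _ _)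
    (fun _ _ => ae_flAt.mpr ⟨fun V _ => by simp only [tPiece, ev₀₀_zero, mul_zero, neg_zero, norm_zero]
                                           have := dfW_pos k; positivity,
      fun V hV => by
        rw [mem_ball, dist_zero_right] at hV
        simp only [tPiece, ev₀₀_atom_succ, norm_neg, norm_mul, Complex.norm_real, Real.norm_eq_abs,
          abs_of_pos (dfW_pos k)]
        exact mul_le_mul_of_nonneg_right hV.le (dfW_pos k).le⟩)
    (fun _ _ => by norm_num)
    (fun _ _ U₀ hU₀ V hV => by
      have hv := norm_ev₀₀_le_half hU₀
      rw [mem_ball, dist_eq_norm, valA, ev₀₀_ref₁] at hV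
      rw [mem_ball, dist_zero_right]
      have hre : ‖(((ev₀₀ U₀).re : ℝ) : ℂ)‖ ≤ 1 / 2 := by
        rw [Complex.norm_real, Real.norm_eq_abs]; exact (Complex.abs_re_le_norm _).trans hv
      calc ‖V‖ = ‖(V - (((ev₀₀ U₀).re : ℝ) : ℂ)) + (((ev₀₀ U₀).re : ℝ) : ℂ)‖ := by rw [sub_add_cancel]
        _ ≤ ‖V - (((ev₀₀ U₀).re : ℝ) : ℂ)‖ + ‖(((ev₀₀ U₀).re : ℝ) : ℂ)‖ := norm_add_le _ _
        _ < 3 + 1 / 2 := by linarith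
        _ = 7 / 2 := by norm_num)
    (fun U₀ hU₀ p hp hp1 => by
      have hN1 : latN p ≤ 1 := hp1.trans (Wm.hwcw (k + 1))
      have hv := norm_ev₀₀_le_half hU₀
      refine ⟨ball 0 ((Wm.ϱc k + 9 / 8) / latN p), isOpen_ball, discs_subset_ball hp hN1 (by linarith), fun _ _ => ⟨?_, ?_⟩⟩
      · simp only [valA, ev₀₀_latMove]; fun_prop
      · intro τ hτ
        have h3 := norm_t_mul_le p hp hτ
        have hre : ‖(((ev₀₀ U₀).re : ℝ) : ℂ)‖ ≤ 1 / 2 := by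
          rw [Complex.norm_real, Real.norm_eq_abs]; exact (Complex.abs_re_le_norm _).trans hv
        rw [valA, valA, ev₀₀_latMove, ev₀₀_ref₁]
        calc ‖ev₀₀ U₀ + τ * ev₀₀ p.1.1 - (((ev₀₀ U₀).re : ℝ) : ℂ)‖
            ≤ ‖ev₀₀ U₀ + τ * ev₀₀ p.1.1‖ + ‖(((ev₀₀ U₀).re : ℝ) : ℂ)‖ := norm_sub_le _ _
          _ ≤ (‖ev₀₀ U₀‖ + ‖τ * ev₀₀ p.1.1‖) + ‖(((ev₀₀ U₀).re : ℝ) : ℂ)‖ := by gcongr; exact norm_add_le _ _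
          _ ≤ (1 / 2 + (Wm.ϱc k + 9 / 8)) + 1 / 2 := by gcongr
          _ ≤ 19 / 24 * 1 * 3 := by linarith)
    (fun _ _ => by norm_num) (fun _ _ => by norm_num)
  rwa [sD_eq] at h

/-! ## §2 The assembled slice-window END with the DERIVED margin as its action margin, the bundle, END-B, the root [folklore] -/

/-- **END-F′-mod-swin ON W9's DATUM WITH THE (w2-act) BINDER SUPPLIED BY ROW S9's JOIN** — leaf-04's
`transportLeaf_assembled_mod_swin_of_schedule Wm …` BY NAME, identical to row W9's `htrA` except that `hE := exponentSliceAt_A_depth`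
(DERIVED through S9 from the depth datum) and the action margin IS the derived history-indexed margin **`s := fun _ k => sD k`** at
every step (gate `budgetGate (TM K) (fun _ k => sD k) ¼ {b} …`; slice sizes `aszRec gen sD 0`). [folklore] -/
theorem htrAD (K : ℕ) :
    (TM K).TransportsFromVar (4 * (1 / 2) / 1) (fun i => (LW ^ 2)⁻¹ * (fun _ : ℕ => alphaCell (1 / 2)) i)
      (budgetGate (TM K) (fun _ k => sD k) (1 / 4) (fun _ b => {b}) (4 * (1 / 2) / 1)
        (fun i => (LW ^ 2)⁻¹ * (fun _ : ℕ => alphaCell (1 / 2)) i)) :=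
  transportLeaf_assembled_mod_swin_of_schedule Wm (T := TM K) (Fn := fun _ k' k => FnA K k' k)
    (rel := fun _ _ _ U U' => U = U') (ref := fun _ _ U => ref₁ U) (base := fun _ _ => base₁) (𝒜 := fun _ _ => 𝒜A)
    (𝒬 := fun _ _ => zeroExp) (q := fun _ _ _ => 0) (μ := fun _ k => flAt (atomW (k + 1))) (z₀ := fun _ _ => 0)
    (z₁ := fun _ _ => 0) (defect := fun _ _ k => defW (k + 1)) (cδ := 1 / 2) (ψ := (LW ^ 2)⁻¹) (m := 1 / 4)
    (s := fun _ k => sD k) (s1 := fun _ _ => 0) (α := fun _ : ℕ => alphaCell (1 / 2))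
    (Asz := aszRec (TM K).gen (fun _ k => sD k) (fun _ _ => 0)) (S := fun _ b => {b}) (Sg := fun _ b => {(b, 0)})
    (c := fun _ _ => (0 : ℂ)) (δf := fun _ k _ => dfW k)
    (fun _ => alphaCell_nonneg (by norm_num)) one_pos (by norm_num) psi_pos.le
    (fun b k' _ _ _ => birthSlice_anti_window (hslA K b k') (Wm.hwcw k'))
    (fun _ k' k _ _ _ _ U => FnA_succ K k' k U) (fun _ _ k _ _ _ _ _ => mem_bddClass_flAt _ _)
    (fun _ _ k _ _ _ _ => realBaseAt_A k _) (fun _ _ k _ _ _ _ => exponentSliceAt_A_depth k)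
    (fun _ _ => by funext U z; simp [zeroExp]) (hSgM K) (fun _ _ => by simp)
    (fun f k'' => aszRec_birth (TM K).gen (fun _ k => sD k) (fun _ _ => 0) f k'')
    (fun f _ _ _ hk => aszRec_succ (TM K).gen (fun _ k => sD k) (fun _ _ => 0) f hk) (fun _ _ => by simp)
    (fun b k p hp => hδfM K k b p hp) (fun _ k _ _ => hδfwkM k) (fun _ k => hDμM k) (fun _ k => hz₁M k)
    (fun _ _ k _ _ _ _ U₀ _ pd _ _ => (relGauge_pairs k).mono fun z hz t _ => hz (latMove U₀ pd t))
    (fun k hk => hdomM K k hk) (fun _ _ _ _ _ h => h ▸ rfl) (fun _ _ _ k _ => aesm_flAt _ _) (fun _ _ k => hdefwkM k)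
    (fun _ k' k _ _ _ => hrateM k' k) (fun b k' k _ _ _ _ ε hε => hlinA K b k' k ε hε)

/-- **THE LEAF BUNDLE AT CUTOFF `K` WITH THE DERIVED MARGIN** — row S3's `bookingLeavesCell` over row W5's ONE `UW` with
`s₀ := fun _ k => sD k` (`hs₀ := sD_le_half` — the derived history-indexed margin is below THE NUMBER at every step), `htr := htrAD K`,
`hbirth := hbirthA K _`, `hreg := hregM K _`, `hcount := hcountM K`. [folklore] -/
def leavesAD (K : ℕ) : BookingLeaves UW (BM K) (TM K) :=
  bookingLeavesCell one_le_LW (by norm_num) le_rfl (by norm_num) zero_le_one zero_le_one (by norm_num) (locCell_LW _).le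
    (by norm_num) (by norm_num) (fun _ => 0) (fun _ k => sD k) (fun _ b => {b}) (fun _ => le_rfl) (fun _ _ => le_rfl)
    (fun k _ _ _ => Nat.zero_le k) (hcountM K) (fun _ k => sD_le_half k) (hbirthA K _) (htrAD K) (hregM K _)

/-- **END-B's PER-CUTOFF FACE** on the datum with the derived margin: the class AND every dressed budget gate `sD k + ¼·Σ envVar ≤ 1`
along the trajectory, at every cutoff. [folklore] -/
theorem classAt_towerAD (K : ℕ) :
    ClassAt (BM K) UW.A₀ UW.ρ₁ UW.τ ∧ ∀ k, k ≤ (BM K).K → RanBelow (budgetGate (TM K) (leavesAD K).s₀ UW.m (leavesAD K).S UW.C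
      (leavesAD K).ρ) k :=
  classAt_of_bookingLeaves (leavesAD K)

/-- THE ROOT THROUGH THE DEPTH-SUPPLIED BUNDLES — `DressedStability towerM` by row S3's `dressedStability_of_cell` over `leavesAD` (an
`example`: the statement is row W7's landed `dressedStability_towerM`; this is a new ROUTE, through S9's join). [folklore] -/
example : DressedStability towerM :=
  dressedStability_of_cell towerM one_le_LW (by norm_num) le_rfl (by norm_num : (0 : ℝ) ≤ 1 / 2) zero_le_one zero_le_one
    (by norm_num) (locCell_LW _).le (by norm_num) (by norm_num) fun _ K => leavesAD K

end Summit.QuantumFields.BalabanUV.T4Continuum.NE1p.DressedTowerWitnessDepth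

end
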